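import Summits.BirchSwinnertonDyer.Rank1Residual.Ordinary.KuriharaExactOrderVocabulary
import Summits.BirchSwinnertonDyer.Rank1Residual.Ordinary.CyclicSylowDivisibility
import Literature.NumberTheory.EllipticCurves.ComplexMultiplicationCoatesWilesReductionIndexProofs
import Summits.BirchSwinnertonDyer.BirchSwinnertonDyer.Theorems.Rank2ObservatoryReductionHom
import Literature.NumberTheory.EllipticCurves.AnomalousOfRationalTorsionProofs
import Literature.NumberTheory.EllipticCurves.AnalyticRankLSeriesSummableProofs
import Literature.NumberTheory.EllipticCurves.ComplexMultiplicationCoatesWilesSeparationProofs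
import HarnessLib

/-!
# `v_ℓ(P) = e_ℓ − v_p(ord P̄)` at a cyclic level: the instruments' point-order formula for the local
# divisibility exponent of C-16 is PROVED (upper bound always; equality when `#Ẽ(𝔽_ℓ)[p] ≤ p`); and two
# remarks on C-16's letter (`3 ∤ #E(ℚ)_tors` and `E(ℚ₃)[3^∞] = 0` follow from `3` good non-anomalous)

HONEST FRAMING (cell `b2b-bsdres`, run/shared/lean/b2b/bsd-rank1-residual/, verbatim in every
file): the goal of the cell is to DELETE the COMBINATION-SHAPED residual classes of the
Birch–Swinnerton-Dyer formula for ALL analytic-rank `≤ 1` elliptic curves over `ℚ` — "full BSD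
formula for every rank `≤ 1` curve in class `C`" assembled STRICTLY from published theorems — so
that the rank-`≤ 1` remainder becomes exactly the CONSTRUCTION-SHAPED classes, which are TYPED
(missing-input `Prop`s), NOT attempted. This is not "finishing BSD". Seat `b2b-bsdres-additive-p3`
(typer-designate for the cell conjecture C-16, hyp R-16 (e)). THEOREMS ONLY, about the VOCABULARY
`localDivExponent` of `Ordinary/KuriharaExactOrderVocabulary.lean` (the `v_ℓ(P)` of C-16 = hyp §120
C120.1) and the letter of `Ordinary/Conjectures/KuriharaExactOrderRankOneAt3.lean`; nothing about any
particular curve is asserted, nothing is booked, no mark / label / count / tier moves; C-16 stays a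
CONJECTURE (data-suggested, never theorem). Group theory: sibling `Ordinary/CyclicSylowDivisibility.lean`.

## What is proved

* §2 (the vocabulary, good `ℓ ≠ p`): **`localDivExponent W p ℓ P + v_p(ord P̄) ≤ v_p #Ẽ(𝔽_ℓ)`** always,
  and **`localDivExponent W p ℓ P = v_p #Ẽ(𝔽_ℓ) − v_p(ord P̄)`** when `#Ẽ(𝔽_ℓ)[p] ≤ p`, in particular
  under C-16's clause `IsCyclicKolyvaginLevel W p ℓ` (`localDivExponent_eq_of_isCyclicKolyvaginLevel`) —
  the P-5 instruments' "ONE point multiplication mod `ℓ`" (`R1-DEPTH-LAW.md` §1) and hyp §120 C120.1's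
  parenthesis «`v_ℓ(P)` = the 3-divisibility exponent of `P̄` in the cyclic group `E(𝔽_ℓ)[3^∞]` (`= e_ℓ`
  when `P̄`'s 3-primary component is `O`)» as theorems about the typed `localDivExponent`; `P̄` = the
  reduction of `P` read on the residue field of `ℤ_ℓ` exactly as in the vocabulary file's
  `localDivExponent_eq_findGreatest_reduction` (AEC VII.2.1 / IV.2.3), `#Ẽ(𝔽_ℓ) = W.reductionPointCount ℓ`
  and the `p`-torsion count transported from `ZMod ℓ`-points by the tree's
  `natCard_point_padicModel_residue` / `residuePointHom` (an injective homomorphism between finite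
  groups of equal order). Corollary: `p^{e_ℓ} ∣ ord P̄ ⟹ v_ℓ(P) = 0`, no cyclicity needed (the
  instruments' designed `v = 0` units / floors).
* §3 (remarks on C-16's letter): `three_dvd_reductionPointCount_iff` (`3 ∣ #Ẽ(𝔽₃) ⟺ a₃ ∈ {1, −2}`, from
  `1 ≤ #Ẽ(𝔽₃) ≤ 7` — the letter's «non-anomalous» reading, no Hasse bound needed); the printed clause
  `3 ∤ #E(ℚ)_tors` follows from `3` good and non-anomalous (tree
  `dvd_frobeniusTrace_sub_one_of_addOrderOf_eq`, AEC VII.3.1(b)) — so the `htors` binder of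
  `KuriharaExactOrderRankOneAtThree` is dischargeable from its neighbours
  (`forall_three_nsmul_eq_zero_of_frobeniusTrace_three`); and the FAITHFULNESS remark behind the
  `m₃(P) = 0` clause, first half: **`E(ℚ₃)[3^∞] = 0`** at a good non-anomalous `3`
  (`forall_pow_three_nsmul_eq_zero_padic_of_frobeniusTrace_three`: a non-zero local `3`-torsion point is
  outside `E₁(ℚ₃)` by AEC IV.6.1, tree `norm_formalParameter_p_nsmul_eq`, so it reduces to a point of
  order `3` in `Ẽ(𝔽₃)`, AEC VII.2.1, tree `exists_reductionHom`).

References: J. H. Silverman, AEC 2nd ed. (2009), IV.6.1, VII.2.1, VII.3.1, IV.2.3 [SilvermanAEC2009];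
hyp `SHARPENED-CONJECTURES.md` §120 C120.1; additive-p3 `R1-DEPTH-LAW.md` §1, §5.
-/

noncomputable section

open scoped Classical

open WeierstrassCurve Literature.NumberTheory.EllipticCurves

namespace Summit.BirchSwinnertonDyer.Rank1Residual.Ordinary

/-! ### §2 The vocabulary: `v_ℓ(P) + v_p(ord P̄) ≤ e_ℓ` -/

section Reduction

/-- `#Ẽ(𝔽_ℓ) = W.reductionPointCount ℓ ≠ 0` (a finite group). [folklore] -/
theorem reductionPointCount_ne_zero (W : WeierstrassCurve ℚ) [W.IsGloballyMinimal] (ℓ : ℕ)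
    [Fact ℓ.Prime] : W.reductionPointCount ℓ ≠ 0 := by
  haveI : NeZero ℓ := ⟨(Fact.out : ℓ.Prime).ne_zero⟩
  rw [reductionPointCount]
  exact Nat.card_pos.ne'

variable (W : WeierstrassCurve ℚ) [W.IsElliptic] [W.IsGloballyMinimal] (p ℓ : ℕ) [Fact p.Prime]
  [Fact ℓ.Prime]

/-- **`v_ℓ(P) + v_p(ord P̄) ≤ e_ℓ = v_p #Ẽ(𝔽_ℓ)`** at a good prime `ℓ ≠ p`: the sentence's local
divisibility exponent `localDivExponent W p ℓ P` is at most the instruments' `e_ℓ − v_p(ord P̄)`, where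
`P̄ ∈ Ẽ(𝔽_ℓ)` is the reduction of `P` (read on the residue field of `ℤ_ℓ` exactly as in
`localDivExponent_eq_findGreatest_reduction`). Equality holds when `Ẽ(𝔽_ℓ)[p^∞]` is cyclic
(`localDivExponent_eq_sub_padicValNat_addOrderOf_reduction`). [cite: SilvermanAEC2009, Prop. VII.2.1 and Prop. IV.2.3] -/
theorem localDivExponent_add_padicValNat_addOrderOf_reduction_le
    (hgood : ¬ (ℓ : ℤ) ∣ minimalDiscriminantInt W) (hℓp : ℓ ≠ p) (P : W.toAffine.Point) :
    localDivExponent W p ℓ P +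
      padicValNat p (addOrderOf (reducePoint ((integralModelInt W).map (Int.castRingHom ℤ_[ℓ]))
        (Affine.Point.congrEquiv (W.padicModel_baseChange ℓ).symm
          (Affine.Point.map (W' := W.toAffine) (Algebra.ofId ℚ ℚ_[ℓ]) P)))) ≤
      padicValNat p (W.reductionPointCount ℓ) := by
  haveI : Finite (((integralModelInt W).map (Int.castRingHom ℤ_[ℓ])).map
      (IsLocalRing.residue ℤ_[ℓ])).toAffine.Point :=
    Nat.finite_of_card_ne_zero (by
      rw [W.natCard_point_padicModel_residue ℓ]
      exact reductionPointCount_ne_zero W ℓ)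
  rw [localDivExponent_eq_findGreatest_reduction W p ℓ hgood (Fact.out) hℓp P,
    ← W.natCard_point_padicModel_residue ℓ]
  exact findGreatest_pow_smul_add_padicValNat_addOrderOf_le _

/-- **Corollary: if `p^{e_ℓ} ∣ ord P̄` (the `p`-primary component of `P̄` has the full order `p^{e_ℓ}`,
so it generates `Ẽ(𝔽_ℓ)[p^∞]`, which is then cyclic), then `v_ℓ(P) = 0`** — `P` is not `p`-divisible in
`E(ℚ_ℓ)`: the instruments' designed "`v = 0` units / floors" levels, certified by ONE order computation
mod `ℓ`, with no cyclicity hypothesis needed in this direction. [cite: SilvermanAEC2009, Prop. VII.2.1 and Prop. IV.2.3] -/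
theorem localDivExponent_eq_zero_of_le_padicValNat_addOrderOf
    (hgood : ¬ (ℓ : ℤ) ∣ minimalDiscriminantInt W) (hℓp : ℓ ≠ p) (P : W.toAffine.Point)
    (h : padicValNat p (W.reductionPointCount ℓ) ≤
      padicValNat p (addOrderOf (reducePoint ((integralModelInt W).map (Int.castRingHom ℤ_[ℓ]))
        (Affine.Point.congrEquiv (W.padicModel_baseChange ℓ).symm
          (Affine.Point.map (W' := W.toAffine) (Algebra.ofId ℚ ℚ_[ℓ]) P))))) :
    localDivExponent W p ℓ P = 0 := by
  have := localDivExponent_add_padicValNat_addOrderOf_reduction_le W p ℓ hgood hℓp P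
  omega

/-! #### Transport of the cyclicity clause from `ZMod ℓ`-points to residue-field points -/

open Summit.BirchSwinnertonDyer.BirchSwinnertonDyer.Rank2Observatory (residuePointHom) in
/-- The points of the reduction read on the residue field of `ℤ_ℓ` and on `ZMod ℓ` have the same number
of `p`-torsion points (the tree's `residuePointHom` along `PadicInt.residueField` is an injective
homomorphism between finite groups of the same order, hence an isomorphism). [folklore] -/
theorem natCard_torsion_residue_eq_natCard_torsion_zmod (W : WeierstrassCurve ℚ) [W.IsGloballyMinimal]
    (ℓ : ℕ) [Fact ℓ.Prime] (p : ℕ) :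
    Nat.card {c : (((integralModelInt W).map (Int.castRingHom ℤ_[ℓ])).map
        (IsLocalRing.residue ℤ_[ℓ])).toAffine.Point // p • c = 0} =
      Nat.card {P : ((integralModelInt W).map (Int.castRingHom (ZMod ℓ))).toAffine.Point //
        p • P = 0} := by
  haveI : NeZero ℓ := ⟨(Fact.out : ℓ.Prime).ne_zero⟩
  set φ := residuePointHom (integralModelInt W) ℓ with hφ
  have hinj : Function.Injective φ := by
    letI := ((PadicInt.residueField (p := ℓ)).toRingHom).toAlgebra
    rw [hφ]
    unfold residuePointHom
    exact (AddEquiv.injective _).comp ((Affine.Point.map_injective _).comp (AddEquiv.injective _))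
  have hcard : Nat.card ((integralModelInt W).map (Int.castRingHom (ZMod ℓ))).toAffine.Point ≤
      Nat.card (((integralModelInt W).map (Int.castRingHom ℤ_[ℓ])).map
        (IsLocalRing.residue ℤ_[ℓ])).toAffine.Point := by
    rw [W.natCard_point_padicModel_residue ℓ, reductionPointCount]
  have hbij : Function.Bijective φ := hinj.bijective_of_nat_card_le hcard
  let e := Equiv.ofBijective φ hbij
  refine Nat.card_congr (e.subtypeEquiv fun c => ?_)
  change p • c = 0 ↔ p • φ c = 0
  rw [← map_nsmul, ← φ.map_zero]
  exact ⟨fun h => by rw [h], fun h => hinj h⟩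

/-- **The cyclic case: `v_ℓ(P) = e_ℓ − v_p(ord P̄)`** at a good prime `ℓ ≠ p` whose reduction has cyclic
`p`-torsion, `#Ẽ(𝔽_ℓ)[p] ≤ p` (the `IsCyclicKolyvaginLevel` clause of C-16, read at the prime `ℓ`):
the sentence's `localDivExponent W p ℓ P` IS the instruments' "ONE point multiplication mod `ℓ`" value.
[cite: SilvermanAEC2009, Prop. VII.2.1 and Prop. IV.2.3] -/
theorem localDivExponent_eq_sub_padicValNat_addOrderOf_reduction
    (hgood : ¬ (ℓ : ℤ) ∣ minimalDiscriminantInt W) (hℓp : ℓ ≠ p)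
    (hcyc : Nat.card {Q : ((integralModelInt W).map (Int.castRingHom (ZMod ℓ))).toAffine.Point //
      p • Q = 0} ≤ p) (P : W.toAffine.Point) :
    localDivExponent W p ℓ P = padicValNat p (W.reductionPointCount ℓ) -
      padicValNat p (addOrderOf (reducePoint ((integralModelInt W).map (Int.castRingHom ℤ_[ℓ]))
        (Affine.Point.congrEquiv (W.padicModel_baseChange ℓ).symm
          (Affine.Point.map (W' := W.toAffine) (Algebra.ofId ℚ ℚ_[ℓ]) P)))) := by
  haveI : Finite (((integralModelInt W).map (Int.castRingHom ℤ_[ℓ])).map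
      (IsLocalRing.residue ℤ_[ℓ])).toAffine.Point :=
    Nat.finite_of_card_ne_zero (by
      rw [W.natCard_point_padicModel_residue ℓ]
      exact reductionPointCount_ne_zero W ℓ)
  rw [← natCard_torsion_residue_eq_natCard_torsion_zmod W ℓ p] at hcyc
  rw [localDivExponent_eq_findGreatest_reduction W p ℓ hgood (Fact.out) hℓp P,
    ← W.natCard_point_padicModel_residue ℓ]
  exact findGreatest_pow_smul_eq_sub_padicValNat_addOrderOf hcyc _

/-- The same under the tree's `IsCyclicKolyvaginLevel W p ℓ` (a cyclic Kolyvagin PRIME `ℓ`, as in C-16's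
letter). [cite: SilvermanAEC2009, Prop. VII.2.1 and Prop. IV.2.3] -/
theorem localDivExponent_eq_of_isCyclicKolyvaginLevel
    (hgood : ¬ (ℓ : ℤ) ∣ minimalDiscriminantInt W) (hℓp : ℓ ≠ p) (hcyc : IsCyclicKolyvaginLevel W p ℓ)
    (P : W.toAffine.Point) :
    localDivExponent W p ℓ P = padicValNat p (W.reductionPointCount ℓ) -
      padicValNat p (addOrderOf (reducePoint ((integralModelInt W).map (Int.castRingHom ℤ_[ℓ]))
        (Affine.Point.congrEquiv (W.padicModel_baseChange ℓ).symm
          (Affine.Point.map (W' := W.toAffine) (Algebra.ofId ℚ ℚ_[ℓ]) P)))) :=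
  localDivExponent_eq_sub_padicValNat_addOrderOf_reduction W p ℓ hgood hℓp (hcyc.2 ℓ dvd_rfl) P

end Reduction

/-! ### §3 A remark on C-16's letter: `3 ∤ #E(ℚ)_tors` follows from `3` good and non-anomalous -/

section Letter

/-- **C-16's printed clause "`3 ∤ #E(ℚ)_tors`" is implied by its clause "`3` good and non-anomalous
(`a₃ ∉ {1, −2}`)":** a rational point of order `3` at a good prime `3` forces `3 ∣ #Ẽ(𝔽₃) = 4 − a₃`
(tree `dvd_frobeniusTrace_sub_one_of_addOrderOf_eq`, AEC VII.3.1(b): `E(ℚ)_tors ↪ Ẽ(𝔽_p)` for odd good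
`p`), and `1 ≤ #Ẽ(𝔽₃) ≤ 7` (tree `natCard_point_le_two_mul_card_add_one`) leaves `a₃ ∈ {1, −2}`. So the
`htors` binder of `KuriharaExactOrderRankOneAtThree` is dischargeable from `hgood`, `ha1`, `ha2` (the
sentence keeps it because it is printed). [cite: SilvermanAEC2009, Prop. VII.3.1(b)] -/
theorem forall_three_nsmul_eq_zero_of_frobeniusTrace_three (W : WeierstrassCurve ℚ) [W.IsElliptic]
    [W.IsGloballyMinimal] (hgood : W.HasGoodReductionAtPrime 3) (ha1 : W.frobeniusTrace 3 ≠ 1)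
    (ha2 : W.frobeniusTrace 3 ≠ -2) (T : W.toAffine.Point) (hT : 3 • T = 0) : T = 0 := by
  by_contra hT0
  haveI : Fact (Nat.Prime 3) := ⟨Nat.prime_three⟩
  have hord : addOrderOf T = 3 := addOrderOf_eq_prime hT hT0
  have hdvd : ((3 : ℕ) : ℤ) ∣ W.frobeniusTrace 3 - 1 :=
    dvd_frobeniusTrace_sub_one_of_addOrderOf_eq W 3 le_rfl hgood hord
  have hN : W.reductionPointCount 3 ≤ 2 * 3 + 1 := by
    have h := natCard_point_le_two_mul_card_add_one
      ((integralModelInt W).map (Int.castRingHom (ZMod 3)))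
    rwa [ZMod.card] at h
  have hN1 : 1 ≤ W.reductionPointCount 3 :=
    Nat.one_le_iff_ne_zero.mpr (reductionPointCount_ne_zero W 3)
  have ha : W.frobeniusTrace 3 = (3 : ℕ) + 1 - (W.reductionPointCount 3 : ℤ) := rfl
  obtain ⟨k, hk⟩ := hdvd
  push_cast at ha hk
  omega

/-- `#Ẽ(𝔽₃) ∈ [1, 7]` and `a₃ = 4 − #Ẽ(𝔽₃)`: **`3 ∣ #Ẽ(𝔽₃)` iff `a₃ ∈ {1, −2}`** — the letter's
"non-anomalous" clause `a₃ ∉ {1, −2}` is `3 ∤ #Ẽ(𝔽₃)` (no Hasse bound needed: at most two `y` per `x`).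
[folklore] -/
theorem three_dvd_reductionPointCount_iff (W : WeierstrassCurve ℚ) [W.IsGloballyMinimal] :
    3 ∣ W.reductionPointCount 3 ↔ W.frobeniusTrace 3 = 1 ∨ W.frobeniusTrace 3 = -2 := by
  haveI : Fact (Nat.Prime 3) := ⟨Nat.prime_three⟩
  have hN : W.reductionPointCount 3 ≤ 2 * 3 + 1 := by
    have h := natCard_point_le_two_mul_card_add_one
      ((integralModelInt W).map (Int.castRingHom (ZMod 3)))
    rwa [ZMod.card] at h
  have hN1 : 1 ≤ W.reductionPointCount 3 :=
    Nat.one_le_iff_ne_zero.mpr (reductionPointCount_ne_zero W 3)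
  have ha : W.frobeniusTrace 3 = (3 : ℕ) + 1 - (W.reductionPointCount 3 : ℤ) := rfl
  push_cast at ha
  omega

/-- **`E(ℚ₃)[3] = 0` at a good non-anomalous `3`** (the FAITHFULNESS remark behind C-16's `m₃(P) = 0`
clause, first half: no local `3`-torsion). A non-zero `P ∈ E(ℚ₃)[3]` is not in `E₁(ℚ₃)` (AEC IV.6.1
with `v(3) = 1 < 3 − 1`: `‖z(3P)‖ = 3⁻¹‖z(P)‖`, tree `norm_formalParameter_p_nsmul_eq`), so it reduces
to a point of order `3` of `Ẽ(𝔽₃)` (AEC VII.2.1, tree `exists_reductionHom`), forcing `3 ∣ #Ẽ(𝔽₃)`,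
i.e. `a₃ ∈ {1, −2}`. [cite: SilvermanAEC2009, IV.6.1 and Prop. VII.2.1] -/
theorem forall_three_nsmul_eq_zero_padic_of_frobeniusTrace_three (W : WeierstrassCurve ℚ)
    [W.IsElliptic] [W.IsGloballyMinimal] (hgood : W.HasGoodReductionAtPrime 3)
    (ha1 : W.frobeniusTrace 3 ≠ 1) (ha2 : W.frobeniusTrace 3 ≠ -2)
    (P : (W.baseChange ℚ_[3]).toAffine.Point) (hP : 3 • P = 0) : P = 0 := by
  haveI : Fact (Nat.Prime 3) := ⟨Nat.prime_three⟩
  by_contra hP0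
  have hΔ := not_dvd_minimalDiscriminantInt_of_hasGoodReductionAtPrime' W 3 hgood
  obtain ⟨r, hr⟩ := exists_reductionHom (W := W) (q := 3) hΔ
  have hker : ∀ Q, r Q = 0 ↔ (W.baseChange ℚ_[3]).IsInReductionKernel Q := fun Q => by
    rw [hr Q]
    exact reducePoint_congrEquiv_eq_zero_iff hΔ Q
  -- `P ∉ E₁(ℚ₃)` (AEC IV.6.1, `3` odd)
  have hnk : ¬ (W.baseChange ℚ_[3]).IsInReductionKernel P := by
    intro hk
    have key := (W.baseChange ℚ_[3]).norm_formalParameter_p_nsmul_eq (p := 3) (by norm_num) hk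
    rw [hP, WeierstrassCurve.formalParameter_zero, norm_zero] at key
    have h3 : (0 : ℝ) < ((3 : ℕ) : ℝ)⁻¹ := by norm_num
    have hz : ‖(W.baseChange ℚ_[3]).formalParameter P‖ = 0 := by
      rcases mul_eq_zero.mp key.symm with h | h
      · exact absurd h h3.ne'
      · exact h
    exact hP0 (((W.baseChange ℚ_[3]).formalParameter_eq_zero_iff hk).mp (norm_eq_zero.mp hz))
  have hrP : r P ≠ 0 := fun h => hnk ((hker P).mp h)
  have h3r : 3 • r P = 0 := by rw [← map_nsmul, hP, map_zero]
  have hord : addOrderOf (r P) = 3 := addOrderOf_eq_prime h3r hrP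
  have hdvd : 3 ∣ W.reductionPointCount 3 := by
    have h := addOrderOf_dvd_natCard (r P)
    rwa [hord, W.natCard_point_padicModel_residue 3] at h
  rcases (three_dvd_reductionPointCount_iff W).mp hdvd with h | h
  · exact ha1 h
  · exact ha2 h

/-- Hence **`E(ℚ₃)[3^∞] = 0`** at a good non-anomalous `3` (induction on the exponent).
[cite: SilvermanAEC2009, IV.6.1 and Prop. VII.2.1] -/
theorem forall_pow_three_nsmul_eq_zero_padic_of_frobeniusTrace_three (W : WeierstrassCurve ℚ)
    [W.IsElliptic] [W.IsGloballyMinimal] (hgood : W.HasGoodReductionAtPrime 3)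
    (ha1 : W.frobeniusTrace 3 ≠ 1) (ha2 : W.frobeniusTrace 3 ≠ -2) (k : ℕ)
    (P : (W.baseChange ℚ_[3]).toAffine.Point) (hP : 3 ^ k • P = 0) : P = 0 := by
  induction k generalizing P with
  | zero => rwa [pow_zero, one_smul] at hP
  | succ k ih =>
    have h3 : 3 • (3 ^ k • P) = 0 := by rw [smul_smul, ← pow_succ', hP]
    have hk : 3 ^ k • P = 0 :=
      forall_three_nsmul_eq_zero_padic_of_frobeniusTrace_three W hgood ha1 ha2 _ h3
    exact ih P hk

end Letter

end Summit.BirchSwinnertonDyer.Rank1Residual.Ordinary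

end
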